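import Mathlib
import Summits.Ventures.HodgeRepro.Tier4.Line1.RTFSetting
import Summits.Ventures.HodgeRepro.Tier4.Line1.MaximalFamily
import Summits.Ventures.HodgeRepro.Tier4.Line1.HeckeFiniteness
import Summits.Ventures.HodgeRepro.Tier4.Line1.HeckeIsolation
import Summits.Ventures.HodgeRepro.Tier4.Line1.JacobsonBlock
import Summits.Ventures.HodgeRepro.Tier4.Line1.HeckeRankOneOfBlock

/-!
# Tier4/Line1/HeckeBlockWeak — the Hecke block with its idempotent identities asked ONLY on the constituents
(module 4a of the self-pointed cut S13690 / S13715 / S13738 / S13823)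

Blind re-derivation cell `pub-hodge-repro`, Tier 4 (README §9–§10), seat t4-L1-p5 (prover, LINE L1, gen 3).  Target tree
path `lean/Summits/Ventures/HodgeRepro/Tier4/Line1/HeckeBlockWeak.lean`.  Imports this seat's `HeckeRankOneOfBlock`
(p684520: `HeckeBlock`, `blockAdmissible`, `pairing`, `target`, `eq_zero_of_mem_block_of_not_idx`) and
`HeckeIsolation` (p683711), t4-L1-p1 g3's `JacobsonBlock` (p684029), `HeckeFiniteness`, `MaximalFamily`.

WHY.  `HeckeBlock` (p684520) asks its idempotent identities `he_R` and `he_adj` for EVERY function `ψ : G → ℂ`; its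
theorems use them only on the constituents (`ψ ∈ τ m'`, continuous and invariant) and on the block.  A concrete
idempotent built from the setting's own integrals (the level average `R(1_K / μ K)`, module 4b) satisfies the
identities on continuous functions but not on arbitrary ones, so the structure is restated here with the identities
asked on the constituents only: `HeckeBlockW` = `HeckeBlock` with
* `he_R : ∀ r m', ∀ ψ ∈ τ m', S.R (tst r) ψ = S.R (tst r) (e ψ)`,
* `he_adj : ∀ m', ∀ ψ ∈ τ m', ∀ v ∈ Vb, S.inner (e ψ) v = S.inner ψ (e v)`,
everything else unchanged.  `HeckeBlock.toW` forgets the stronger form; `HeckeBlockW.exists_hecke_rankOne` and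
`HeckeBlockW.exists_isolatedAt_hecke` re-run the proofs of `HeckeRankOneOfBlock.heckeRankOne` /
`HeckeIsolationHecke.exists_isolatedAt_hecke` on the weak fields (the same algebra, the identities invoked only at
constituents and block vectors).  Nothing of (C1), (C2), the block data or the idempotent identities is proved here.
Nothing here says anything about the status of the Hodge conjecture for CM abelian varieties, which is NOT proved
(HC_CM is NOT proved by anyone in this repository).
-/

set_option autoImplicit false

noncomputable section

namespace Summit.Ventures.HodgeRepro.Tier4.Line1

namespace RTF.Setting

variable {G : Type} [Group G] [TopologicalSpace G] [IsTopologicalGroup G] [MeasurableSpace G] [BorelSpace G]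
  (S : Setting G)

/-- **A FINITE HECKE BLOCK WITH ITS LEVEL IDEMPOTENT, the identities asked on the constituents only** (the fields of
`HeckeBlock` p684520 with `he_R` and `he_adj` restricted to `ψ ∈ τ m'`).  Every field is a HYPOTHESIS of the theorems
below; the spherical instance (module 4b) constructs one from the setting's own level average. -/
structure HeckeBlockW (τ : ℕ → Set (G → ℂ)) (m : ℕ) (H : Type) [Ring H] [Algebra ℂ H] (ι : Type) [Fintype ι]
    [DecidableEq ι] (Vb : Submodule ℂ (G → ℂ)) [FiniteDimensional ℂ Vb] [Module H Vb] [IsScalarTower ℂ H Vb] where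
  /-- the Hecke elements as test functions -/
  tst : H → (G → ℂ)
  /-- every Hecke element is a test function -/
  htst : ∀ r, IsTest (tst r)
  /-- the `H`-action on the block IS the right-regular action of the test functions (the convolution law) -/
  hact : ∀ (r : H) (ψ : Vb), ((r • ψ : Vb) : G → ℂ) = S.R (tst r) ψ
  /-- the constituents of the block, by index -/
  idx : ι → ℕ
  /-- the index of `τ m` -/
  i₀ : ι
  /-- `τ m` is the `i₀`-th constituent -/
  hi₀ : idx i₀ = m
  /-- the constituents as `H`-submodules of the block -/
  W : ι → Submodule H Vb
  /-- `W i = τ (idx i) ∩ Vb` -/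
  hW : ∀ (i : ι) (ψ : Vb), ψ ∈ W i ↔ (ψ : G → ℂ) ∈ τ (idx i)
  /-- the `H`-linear projections onto the constituents -/
  π : ι → Vb →ₗ[H] Vb
  /-- `π i` lands in `W i` -/
  hπmem : ∀ i v, π i v ∈ W i
  /-- the projections sum to the identity -/
  hπsum : ∀ v, ∑ i, π i v = v
  /-- `π i` is the identity on `W i` -/
  hπid : ∀ i, ∀ w ∈ W i, π i w = w
  /-- `π i` kills `W j` for `j ≠ i` -/
  hπzero : ∀ i j, i ≠ j → ∀ w ∈ W j, π i w = 0
  /-- (C1): every constituent of the block is a simple `H`-module -/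
  [simple : ∀ i, IsSimpleModule H (W i)]
  /-- (C2): the constituents are pairwise non-isomorphic `H`-modules -/
  hnon : ∀ i j, i ≠ j → IsEmpty ((W i) ≃ₗ[H] (W j))
  /-- the level idempotent -/
  e : (G → ℂ) → (G → ℂ)
  /-- `e` maps every constituent into the block and into the constituent -/
  he_mem : ∀ m', ∀ ψ ∈ τ m', e ψ ∈ Vb ∧ e ψ ∈ τ m'
  /-- every Hecke element factors through `e` ON THE CONSTITUENTS -/
  he_R : ∀ (r : H) (m' : ℕ), ∀ ψ ∈ τ m', S.R (tst r) ψ = S.R (tst r) (e ψ)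
  /-- `e` is self-adjoint for the `L²(D_G)` pairing BETWEEN CONSTITUENTS AND BLOCK VECTORS -/
  he_adj : ∀ m', ∀ ψ ∈ τ m', ∀ v ∈ Vb, S.inner (e ψ) v = S.inner ψ (e v)
  /-- `e` is the identity on the block -/
  he_id : ∀ v ∈ Vb, e v = v

namespace HeckeBlock

variable {S} {τ : ℕ → Set (G → ℂ)} {m : ℕ} {H : Type} [Ring H] [Algebra ℂ H] {ι : Type} [Fintype ι] [DecidableEq ι]
  {Vb : Submodule ℂ (G → ℂ)} [FiniteDimensional ℂ Vb] [Module H Vb] [IsScalarTower ℂ H Vb]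

omit [IsTopologicalGroup G] [BorelSpace G] in
/-- a `HeckeBlock` is a `HeckeBlockW` (the identities for all functions restrict to the constituents). -/
def toW (D : HeckeBlock S τ m H ι Vb) : HeckeBlockW S τ m H ι Vb where
  tst := D.tst
  htst := D.htst
  hact := D.hact
  idx := D.idx
  i₀ := D.i₀
  hi₀ := D.hi₀
  W := D.W
  hW := D.hW
  π := D.π
  hπmem := D.hπmem
  hπsum := D.hπsum
  hπid := D.hπid
  hπzero := D.hπzero
  simple := D.simple
  hnon := D.hnon
  e := D.e
  he_mem := D.he_mem
  he_R := fun r _ ψ _ => D.he_R r ψ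
  he_adj := fun _ ψ _ v _ => D.he_adj ψ v
  he_id := D.he_id

end HeckeBlock

namespace HeckeBlockW

variable {S} {τ : ℕ → Set (G → ℂ)} {m : ℕ} {H : Type} [Ring H] [Algebra ℂ H] {ι : Type} [Fintype ι] [DecidableEq ι]
  {Vb : Submodule ℂ (G → ℂ)} [FiniteDimensional ℂ Vb] [Module H Vb] [IsScalarTower ℂ H Vb]
  (D : HeckeBlockW S τ m H ι Vb)

omit [IsTopologicalGroup G] [BorelSpace G] in
/-- a vector of the `i`-th constituent is continuous. -/
theorem continuous_of_mem (hinv : ∀ m', S.IsInvariantSubspace (τ m')) {i : ι} {ψ : Vb} (hψ : ψ ∈ D.W i) :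
    Continuous (ψ : G → ℂ) :=
  (hinv (D.idx i)).cont _ ((D.hW i ψ).mp hψ)

omit [IsTopologicalGroup G] in
/-- the pairing against a fixed continuous `v` is a ℂ-linear functional on the `i`-th constituent. -/
def pairing (hinv : ∀ m', S.IsInvariantSubspace (τ m')) {v : G → ℂ} (hv : Continuous v) (i : ι) :
    D.W i →ₗ[ℂ] ℂ where
  toFun x := S.inner (x : G → ℂ) v
  map_add' x y := by
    have hx := D.continuous_of_mem hinv x.2
    have hy := D.continuous_of_mem hinv y.2
    have h := S.inner_add_left' hx hy hv
    simp only [Submodule.coe_add]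
    rw [← h]
    rfl
  map_smul' c x := by
    have hx := D.continuous_of_mem hinv x.2
    have h := S.inner_smul_left' hx hv c
    simp only [RingHom.id_apply, smul_eq_mul]
    rw [Submodule.coe_smul_of_tower, Submodule.coe_smul]
    exact h

omit [IsTopologicalGroup G] [BorelSpace G] in
/-- the target vector of the rank-one family: `w` in the `i₀`-th constituent, `0` in the others. -/
def target {w : G → ℂ} (hw : w ∈ blockAdmissible τ m Vb) (i : ι) : D.W i :=
  if h : i = D.i₀ then ⟨⟨w, hw.1⟩, by rw [h, D.hW, D.hi₀]; exact hw.2⟩ else 0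

omit [IsTopologicalGroup G] [BorelSpace G] in
/-- the target vector away from `i₀`. -/
theorem target_ne {w : G → ℂ} (hw : w ∈ blockAdmissible τ m Vb) {i : ι} (hi : i ≠ D.i₀) : D.target hw i = 0 := by
  simp only [target, dif_neg hi]

omit [IsTopologicalGroup G] in
/-- a vector of a constituent outside the block that lies in the block is zero (as in `HeckeRankOneOfBlock`). -/
theorem eq_zero_of_mem_block_of_not_idx [Countable S.Gk] [MeasurableMul G] {φ : ℕ → G → ℂ} {n : ℕ → ℕ}
    (hB : S.IsAdaptedONB τ φ n) {m' : ℕ} (hm' : ∀ i, D.idx i ≠ m') {ψ : G → ℂ} (hψV : ψ ∈ Vb)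
    (hψτ : ψ ∈ τ m') : ψ = 0 := by
  classical
  by_contra hne
  have hψc : Continuous ψ := (hB.inv m').cont ψ hψτ
  have hψi : S.Invariant ψ := (hB.inv m').inv ψ hψτ
  apply S.inner_self_ne_zero_of_invariant hψc hψi hne
  have hsum : (⟨ψ, hψV⟩ : Vb) = ∑ i, D.π i ⟨ψ, hψV⟩ := (D.hπsum _).symm
  have h := congrArg (fun z : Vb => (z : G → ℂ)) hsum
  simp only [Submodule.coe_sum] at h
  have hfun : (fun x => ∑ i ∈ Finset.univ, (1 : ℂ) * ((D.π i ⟨ψ, hψV⟩ : Vb) : G → ℂ) x) = ψ := by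
    funext x
    simp only [one_mul]
    have hx := congrFun h x
    rw [Finset.sum_apply] at hx
    exact hx.symm
  have hcont : ∀ i ∈ (Finset.univ : Finset ι), Continuous ((D.π i ⟨ψ, hψV⟩ : Vb) : G → ℂ) := fun i _ =>
    D.continuous_of_mem hB.inv (D.hπmem i _)
  calc S.inner ψ ψ = S.inner (fun x => ∑ i ∈ Finset.univ, (1 : ℂ) * ((D.π i ⟨ψ, hψV⟩ : Vb) : G → ℂ) x) ψ := by
        rw [hfun]
    _ = ∑ i ∈ Finset.univ, (1 : ℂ) * S.inner ((D.π i ⟨ψ, hψV⟩ : Vb) : G → ℂ) ψ :=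
        S.inner_finset_sum_left ψ hψc Finset.univ (fun _ => (1 : ℂ)) _ hcont
    _ = 0 := by
        refine Finset.sum_eq_zero fun i _ => ?_
        have hmem : ((D.π i ⟨ψ, hψV⟩ : Vb) : G → ℂ) ∈ τ (D.idx i) := (D.hW i _).mp (D.hπmem i _)
        rw [hB.orthSub (D.idx i) m' (hm' i) _ hmem ψ hψτ, mul_zero]

omit [IsTopologicalGroup G] in
/-- **the rank-one Hecke element from the weak block**: for admissible `v, w` there is `r ∈ H` whose test function
`tst r` kills every other constituent and acts on `τ m` as `⟪·, v⟫ w` (the proof of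
`HeckeRankOneOfBlock.heckeRankOne`, the identities invoked only at constituents and block vectors). -/
theorem exists_hecke_rankOne [Countable S.Gk] [MeasurableMul G] {φ : ℕ → G → ℂ} {n : ℕ → ℕ}
    (hB : S.IsAdaptedONB τ φ n) {v w : G → ℂ} (hv : v ∈ blockAdmissible τ m Vb) (hw : w ∈ blockAdmissible τ m Vb) :
    ∃ r : H, (∀ m', m' ≠ m → ∀ ψ ∈ τ m', S.R (D.tst r) ψ = fun _ => 0) ∧
      (∀ ψ ∈ τ m, S.R (D.tst r) ψ = fun x => S.inner ψ v * w x) := by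
  classical
  haveI := D.simple
  have hvc : Continuous v := (hB.inv m).cont v hv.2
  let T : ∀ i, Module.End ℂ (D.W i) := fun i => (D.pairing hB.inv hvc i).smulRight (D.target hw i)
  obtain ⟨r, hr⟩ := JacobsonBlock.blockAlgebra_realises D.W D.π D.hπmem D.hπsum D.hπid D.hπzero D.hnon T
  refine ⟨r, ?_, ?_⟩
  · intro m' hm' ψ hψ
    obtain ⟨heV, heτ⟩ := D.he_mem m' ψ hψ
    rw [D.he_R r m' ψ hψ]
    by_cases hidx : ∃ i, D.idx i = m'
    · obtain ⟨i, hi⟩ := hidx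
      have hi₀ : i ≠ D.i₀ := by
        intro h
        apply hm'
        rw [← hi, h, D.hi₀]
      have hmem : (⟨D.e ψ, heV⟩ : Vb) ∈ D.W i := by
        rw [D.hW, hi]
        exact heτ
      have h1 := hr i _ hmem
      have h2 : (T i ⟨⟨D.e ψ, heV⟩, hmem⟩ : Vb) = 0 := by
        simp only [T, LinearMap.smulRight_apply, D.target_ne hw hi₀, smul_zero, Submodule.coe_zero]
      rw [h2] at h1
      have h3 := D.hact r ⟨D.e ψ, heV⟩
      rw [h1] at h3
      funext x
      have := congrFun h3 x
      simpa using this.symm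
    · have hidx' : ∀ i, D.idx i ≠ m' := fun i h => hidx ⟨i, h⟩
      have h0 : D.e ψ = 0 := D.eq_zero_of_mem_block_of_not_idx hB hidx' heV heτ
      rw [h0, S.R_zero]
      rfl
  · intro ψ hψ
    obtain ⟨heV, heτ⟩ := D.he_mem m ψ hψ
    rw [D.he_R r m ψ hψ]
    have hmem : (⟨D.e ψ, heV⟩ : Vb) ∈ D.W D.i₀ := by
      rw [D.hW, D.hi₀]
      exact heτ
    have h1 := hr D.i₀ _ hmem
    have h2 : (T D.i₀ ⟨⟨D.e ψ, heV⟩, hmem⟩ : Vb) = S.inner (D.e ψ) v • (⟨w, hw.1⟩ : Vb) := by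
      simp only [T, LinearMap.smulRight_apply]
      rw [Submodule.coe_smul_of_tower]
      have ht : (D.target hw D.i₀ : Vb) = ⟨w, hw.1⟩ := by
        simp only [target, dif_pos]
      rw [ht]
      rfl
    rw [h2] at h1
    have h3 := D.hact r ⟨D.e ψ, heV⟩
    rw [h1] at h3
    have h4 : S.inner (D.e ψ) v = S.inner ψ v := by
      rw [D.he_adj m ψ hψ v hv.1, D.he_id v hv.1]
    funext x
    have := congrFun h3 x
    simp only [Submodule.coe_smul, Pi.smul_apply, smul_eq_mul] at this
    rw [← this, h4]

omit [IsTopologicalGroup G] in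
include D in
/-- `HeckeRankOne` from the weak block. -/
theorem heckeRankOne [Countable S.Gk] [MeasurableMul G] {φ : ℕ → G → ℂ} {n : ℕ → ℕ}
    (hB : S.IsAdaptedONB τ φ n) : HeckeRankOne S τ m (blockAdmissible τ m Vb) := by
  intro v hv w hw
  obtain ⟨r, hkill, hm⟩ := D.exists_hecke_rankOne hB hv hw
  exact ⟨D.tst r, D.htst r, hkill, hm⟩

omit [IsTopologicalGroup G] in
/-- **(S3a) from the weak block, the isolating pair in the Hecke algebra**. -/
theorem exists_isolatedAt_hecke [Countable S.Gk] [MeasurableMul G] {χ : S.T → ℂ} {χ' : S.T' → ℂ}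
    {φ : ℕ → G → ℂ} {n : ℕ → ℕ} (hB : S.IsAdaptedONB τ φ n)
    (hT : ∃ w ∈ blockAdmissible τ m Vb, S.periodT χ (fun t => w t) ≠ 0)
    (hT' : ∃ w' ∈ blockAdmissible τ m Vb, S.periodT' χ' (fun t' => w' t') ≠ 0) :
    ∃ r r' : H, IsolatedAt S χ χ' φ n (cj (D.tst r)) (refl (D.tst r')) m := by
  obtain ⟨w, hwV, hw⟩ := hT
  obtain ⟨w', hw'V, hw'⟩ := hT'
  obtain ⟨r, hrkill, hrm⟩ := D.exists_hecke_rankOne hB hwV hwV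
  obtain ⟨r', _, hr'm⟩ := D.exists_hecke_rankOne hB hwV hw'V
  refine ⟨r, r', ?_, ?_⟩
  · intro m' hm'
    apply S.specBlock_eq_zero_of_R_eq_zero χ χ' φ n (cj (D.tst r)) (refl (D.tst r')) hB
    intro ψ hψ
    rw [cj_cj]
    exact hrkill m' hm' ψ hψ
  · have hwm : w ∈ τ m := hwV.2
    have hblock := S.specBlock_eq_of_rankOne χ χ' φ n (cj (D.tst r)) (refl (D.tst r')) hB hwm hwm
      (fun ψ hψ => by rw [cj_cj]; exact hrm ψ hψ) (fun ψ hψ => by rw [refl_refl]; exact hr'm ψ hψ)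
    rw [hblock]
    have hw0 : w ≠ 0 := by
      intro h0
      apply hw
      rw [h0]
      exact S.periodT_zero
    have hww : S.inner w w ≠ 0 :=
      S.inner_self_ne_zero_of_invariant ((hB.inv m).cont w hwm) ((hB.inv m).inv w hwm) hw0
    exact mul_ne_zero (mul_ne_zero hw' (by simpa using hw)) hww

end HeckeBlockW

end RTF.Setting

end Summit.Ventures.HodgeRepro.Tier4.Line1

end
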